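import Summits.CriticalPhenomena.PercolationContinuityZ3.Theorems.PercNearOneGluingNoHeavyLowerTailSunflowerOrPetalCodes
import HarnessLib

/-!
# `NoHeavyLowerTail` (crux stmt-CriticalPhenomena-4575), abstract sunflower cubic: the COUNTING LEMMA of the bottom sector —
# three-block placements with two blocks in a down-closed family

Support file (seat `prim-ineq-gen-2` gen 23; `--supports stmt-CriticalPhenomena-4575`).  No `sorry`, no named facts.  Second of four files
proving (♣) behind every disjunctive petal.  Pure finite combinatorics, independent of sunflowers.

LEMMA (`card_twoIn_ge`).  Let `𝒟` be a family of proper nonempty subsets of a finite set `S₀`, closed under nonempty subsets, such that no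
member of `𝒟` is the complement of a singleton member.  Then the ordered placements `(X, Y, S₀∖(X∪Y))` of `S₀` into three nonempty blocks
with AT LEAST TWO blocks in `𝒟` (`placements3`, `TwoIn`) number at least `3·(#𝒟 − 1)`.

PROOF.  Let `V = {v : {v} ∈ 𝒟}`; every member of `𝒟` lies in `V`.  Fix an injection `ι : α → ℕ` and for `τ ∈ 𝒟' = 𝒟 ∖ {V}` let `v_τ` be the
`ι`-least point of `V ∖ τ` and `R_τ = S₀ ∖ (τ ∪ {v_τ})` (nonempty by the complement hypothesis).  The three rotations
`τ ↦ (τ, {v_τ}, R_τ)`, `({v_τ}, R_τ, τ)`, `(R_τ, τ, {v_τ})` are injections `𝒟' → ` admissible placements.  If some point of `S₀` is not in `V`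
it lies in every `R_τ`, which rules out every coincidence between two of the images (a coincidence forces some `R_σ` to be a singleton of `V`
or a member of `𝒟`), giving `3·#𝒟' ≥ 3(#𝒟 − 1)` placements.  If `V = S₀` then `V ∉ 𝒟`, `𝒟' = 𝒟`, and a coincidence between two images
forces a placement built from the `ι`-least point `a` of `S₀` (and `v_{a}`), so each pairwise intersection has at most one element:
`≥ 3·#𝒟 − 3` placements (inclusion–exclusion).  Memo: run/shared/lean/prim/prim-ineq-gen-2/gen23/CLUB-ORPETAL-ALL-R.md §4.
-/

namespace Summit.CriticalPhenomena.PercolationContinuityZ3.Theorems.SunflowerPartition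

open Finset

variable {α : Type*} [DecidableEq α]

/-- The three-block placements of `S₀` as dependent pairs `⟨X, Y⟩`, `X ∈ propers S₀`, `Y ∈ propers (S₀ ∖ X)` (third block
`S₀ ∖ (X ∪ Y)`). [this work] -/
def placements3 (S₀ : Finset α) : Finset (Σ _ : Finset α, Finset α) := (propers S₀).sigma fun X => propers (S₀ \ X)

/-- At least two of the three blocks of a placement lie in the family `𝒟`. [this work] -/
abbrev TwoIn (S₀ : Finset α) (𝒟 : Finset (Finset α)) (p : Σ _ : Finset α, Finset α) : Prop :=
  (p.1 ∈ 𝒟 ∧ p.2 ∈ 𝒟) ∨ (p.1 ∈ 𝒟 ∧ S₀ \ (p.1 ∪ p.2) ∈ 𝒟) ∨ (p.2 ∈ 𝒟 ∧ S₀ \ (p.1 ∪ p.2) ∈ 𝒟)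

/-- Blocks of the placements built from `τ` and a point `v ∉ τ`: with `R = S₀ ∖ insert v τ`,
`S₀ ∖ ({v} ∪ R) = τ`, `S₀ ∖ (R ∪ τ) = {v}`, `S₀ ∖ R = insert v τ`. [folklore] -/
theorem sdiff_blocks_point {S₀ τ : Finset α} {v : α} (hτ : τ ⊆ S₀) (hv : v ∈ S₀) (hvτ : v ∉ τ) :
    S₀ \ ({v} ∪ (S₀ \ insert v τ)) = τ ∧ S₀ \ ((S₀ \ insert v τ) ∪ τ) = {v} ∧ S₀ \ (S₀ \ insert v τ) = insert v τ := by
  refine ⟨?_, ?_, ?_⟩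
  · ext x
    rw [mem_sdiff, mem_union, mem_singleton, mem_sdiff, mem_insert]
    constructor
    · rintro ⟨hxS, hn⟩
      by_contra hxτ
      by_cases hxv : x = v
      · exact hn (Or.inl hxv)
      · exact hn (Or.inr ⟨hxS, fun h => h.elim hxv hxτ⟩)
    · intro hx
      refine ⟨hτ hx, fun h => h.elim (fun hxv => hvτ (hxv ▸ hx)) (fun h' => h'.2 (Or.inr hx))⟩
  · ext x
    rw [mem_sdiff, mem_union, mem_sdiff, mem_insert, mem_singleton]
    constructor
    · rintro ⟨hxS, hn⟩
      by_contra hxv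
      by_cases hxτ : x ∈ τ
      · exact hn (Or.inr hxτ)
      · exact hn (Or.inl ⟨hxS, fun h => h.elim hxv hxτ⟩)
    · rintro rfl
      exact ⟨hv, fun h => h.elim (fun h' => h'.2 (Or.inl rfl)) (fun hvτ' => hvτ hvτ')⟩
  · rw [Finset.sdiff_sdiff_eq_self (insert_subset hv hτ)]

/-- **LEMMA** (the bottom sector's counting step).  Let `𝒟` be a family of proper nonempty subsets of `S₀`, closed under nonempty
subsets, such that no member is the complement of a singleton member.  Then the three-block placements of `S₀` with at least two
blocks in `𝒟` number at least `3·(#𝒟 − 1)`.  Proof: with `V` the set of points whose singleton is in `𝒟` (so every member of `𝒟`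
lies in `V`) and, for `τ ∈ 𝒟 ∖ {V}`, `v_τ` the `ι`-least point of `V ∖ τ`, the three rotations of `τ ↦ (τ, {v_τ}, rest)` are
injections into these placements whose images are pairwise disjoint when `V ≠ S₀` and meet in at most one placement each when
`V = S₀ ∉ 𝒟`. [this work] -/
theorem card_twoIn_ge (S₀ : Finset α) (𝒟 : Finset (Finset α)) (ι : α → ℕ) (hι : Function.Injective ι)
    (hD1 : 𝒟 ⊆ propers S₀) (hD2 : ∀ τ ∈ 𝒟, ∀ τ' : Finset α, τ' ⊆ τ → τ'.Nonempty → τ' ∈ 𝒟)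
    (hD3 : ∀ τ ∈ 𝒟, ∀ v : α, ({v} : Finset α) ∈ 𝒟 → S₀ \ τ ≠ {v}) :
    3 * ((𝒟.card : ℤ) - 1) ≤ (((placements3 S₀).filter (TwoIn S₀ 𝒟)).card : ℤ) := by
  classical
  -- trivial when `𝒟 = ∅`
  rcases 𝒟.eq_empty_or_nonempty with rfl | hne
  · simp
  obtain ⟨τ₀, hτ₀⟩ := hne
  haveI : Nonempty α := by
    obtain ⟨h1, h2, _⟩ := mem_propers.1 (hD1 hτ₀)
    obtain ⟨x, _⟩ := nonempty_iff_ne_empty.2 h2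
    exact ⟨x⟩
  -- the vertex set `V` and the reduced family `𝒟'`
  set V : Finset α := S₀.filter fun v => ({v} : Finset α) ∈ 𝒟 with hV
  have hVS : V ⊆ S₀ := filter_subset _ _
  have memV : ∀ {v}, v ∈ V ↔ v ∈ S₀ ∧ ({v} : Finset α) ∈ 𝒟 := fun {v} => by rw [hV, mem_filter]
  have subV : ∀ τ ∈ 𝒟, τ ⊆ V := by
    intro τ hτ x hx
    have hτS := (mem_propers.1 (hD1 hτ)).1
    exact memV.2 ⟨hτS hx, hD2 τ hτ {x} (singleton_subset_iff.2 hx) (singleton_nonempty x)⟩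
  set 𝒟' := 𝒟.erase V with h𝒟'
  have h𝒟'sub : 𝒟' ⊆ 𝒟 := erase_subset _ _
  -- the least point of `V ∖ τ`
  have hex : ∀ τ ∈ 𝒟', ∃ v, v ∈ V \ τ ∧ ∀ x ∈ V \ τ, ι v ≤ ι x := by
    intro τ hτ
    obtain ⟨hne', hτ𝒟⟩ := mem_erase.1 hτ
    have hn : (V \ τ).Nonempty := by
      rw [nonempty_iff_ne_empty]
      intro he
      exact hne' (Subset.antisymm (subV τ hτ𝒟) (sdiff_eq_empty_iff_subset.1 he))
    obtain ⟨v, hv, hmin⟩ := exists_min_image (V \ τ) ι hn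
    exact ⟨v, hv, hmin⟩
  choose! v hvmem hvmin using hex
  -- basic facts about `v τ` and `R τ := S₀ \ insert (v τ) τ`
  have vfacts : ∀ τ ∈ 𝒟', τ ⊆ S₀ ∧ τ.Nonempty ∧ v τ ∈ S₀ ∧ v τ ∉ τ ∧ ({v τ} : Finset α) ∈ 𝒟 ∧ τ ∈ 𝒟
      ∧ (S₀ \ insert (v τ) τ).Nonempty := by
    intro τ hτ
    have hτ𝒟 := h𝒟'sub hτ
    obtain ⟨hτS, hτne, _⟩ := mem_propers.1 (hD1 hτ𝒟)
    obtain ⟨hvV, hvτ⟩ := mem_sdiff.1 (hvmem τ hτ)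
    obtain ⟨hvS, hv𝒟⟩ := memV.1 hvV
    refine ⟨hτS, nonempty_iff_ne_empty.2 hτne, hvS, hvτ, hv𝒟, hτ𝒟, ?_⟩
    rw [nonempty_iff_ne_empty]
    intro he
    apply hD3 τ hτ𝒟 (v τ) hv𝒟
    refine Subset.antisymm ?_ (singleton_subset_iff.2 (mem_sdiff.2 ⟨hvS, hvτ⟩))
    intro x hx
    obtain ⟨hxS, hxτ⟩ := mem_sdiff.1 hx
    rw [mem_singleton]
    by_contra hxv
    have : x ∈ S₀ \ insert (v τ) τ := mem_sdiff.2 ⟨hxS, fun hh => (mem_insert.1 hh).elim hxv hxτ⟩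
    rw [he] at this
    exact notMem_empty x this
  -- the three maps
  let f₁ : Finset α → (Σ _ : Finset α, Finset α) := fun τ => ⟨τ, {v τ}⟩
  let f₂ : Finset α → (Σ _ : Finset α, Finset α) := fun τ => ⟨{v τ}, S₀ \ insert (v τ) τ⟩
  let f₃ : Finset α → (Σ _ : Finset α, Finset α) := fun τ => ⟨S₀ \ insert (v τ) τ, τ⟩
  set T := (placements3 S₀).filter (TwoIn S₀ 𝒟) with hT
  have memT : ∀ {X Y : Finset α}, X ∈ propers S₀ → Y ∈ propers (S₀ \ X) → TwoIn S₀ 𝒟 ⟨X, Y⟩ →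
      (⟨X, Y⟩ : Σ _ : Finset α, Finset α) ∈ T := by
    intro X Y hX hY h2
    rw [hT, mem_filter, placements3, mem_sigma]
    exact ⟨⟨hX, hY⟩, h2⟩
  have hf₁ : ∀ τ ∈ 𝒟', f₁ τ ∈ T := by
    intro τ hτ
    obtain ⟨hτS, hτne, hvS, hvτ, hv𝒟, hτ𝒟, hR⟩ := vfacts τ hτ
    refine memT (hD1 hτ𝒟) (mem_propers.2 ⟨singleton_subset_iff.2 (mem_sdiff.2 ⟨hvS, hvτ⟩), singleton_ne_empty _,
      fun he => hD3 τ hτ𝒟 (v τ) hv𝒟 he.symm⟩) (Or.inl ⟨hτ𝒟, hv𝒟⟩)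
  have hf₂ : ∀ τ ∈ 𝒟', f₂ τ ∈ T := by
    intro τ hτ
    obtain ⟨hτS, hτne, hvS, hvτ, hv𝒟, hτ𝒟, hR⟩ := vfacts τ hτ
    obtain ⟨e1, _, _⟩ := sdiff_blocks_point hτS hvS hvτ
    refine memT (mem_propers.2 ⟨singleton_subset_iff.2 hvS, singleton_ne_empty _, fun he => ?_⟩)
      (mem_propers.2 ⟨sdiff_subset_sdiff subset_rfl (singleton_subset_iff.2 (mem_insert_self _ _)), hR.ne_empty, fun he => ?_⟩)
      (Or.inr (Or.inl ⟨hv𝒟, by rw [e1]; exact hτ𝒟⟩))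
    · obtain ⟨x, hx⟩ := hτne
      have : x ∈ ({v τ} : Finset α) := he ▸ hτS hx
      rw [mem_singleton] at this
      exact hvτ (this ▸ hx)
    · obtain ⟨x, hx⟩ := hτne
      have hx' : x ∈ S₀ \ {v τ} := mem_sdiff.2 ⟨hτS hx, fun hh => hvτ ((mem_singleton.1 hh) ▸ hx)⟩
      rw [← he, mem_sdiff, mem_insert] at hx'
      exact hx'.2 (Or.inr hx)
  have hf₃ : ∀ τ ∈ 𝒟', f₃ τ ∈ T := by
    intro τ hτ
    obtain ⟨hτS, hτne, hvS, hvτ, hv𝒟, hτ𝒟, hR⟩ := vfacts τ hτ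
    obtain ⟨_, e2, e3⟩ := sdiff_blocks_point hτS hvS hvτ
    refine memT (mem_propers.2 ⟨sdiff_subset, hR.ne_empty, fun he => ?_⟩)
      (mem_propers.2 ⟨?_, hτne.ne_empty, fun he => ?_⟩) (Or.inr (Or.inr ⟨hτ𝒟, by rw [e2]; exact hv𝒟⟩))
    · have : v τ ∈ S₀ \ insert (v τ) τ := he.symm ▸ hvS
      rw [mem_sdiff, mem_insert] at this
      exact this.2 (Or.inl rfl)
    · rw [e3]; exact subset_insert _ _
    · rw [e3] at he
      have hm : v τ ∈ insert (v τ) τ := mem_insert_self _ _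
      rw [← he] at hm
      exact hvτ hm
  -- injectivity
  have inj₁ : Set.InjOn f₁ 𝒟' := fun τ _ τ' _ h => by
    have := congrArg Sigma.fst h; exact this
  have third : ∀ τ ∈ 𝒟', S₀ \ (({v τ} : Finset α) ∪ (S₀ \ insert (v τ) τ)) = τ := by
    intro τ hτ
    obtain ⟨hτS, _, hvS, hvτ, _⟩ := vfacts τ hτ
    exact (sdiff_blocks_point hτS hvS hvτ).1
  have inj₂ : Set.InjOn f₂ 𝒟' := fun τ hτ τ' hτ' h => by
    have h1 : ({v τ} : Finset α) = {v τ'} := congrArg Sigma.fst h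
    have h2 : S₀ \ insert (v τ) τ = S₀ \ insert (v τ') τ' := eq_of_heq (Sigma.mk.inj h).2
    rw [← third τ hτ, ← third τ' hτ', h1, h2]
  have inj₃ : Set.InjOn f₃ 𝒟' := fun τ _ τ' _ h => eq_of_heq (Sigma.mk.inj h).2
  -- image cardinalities and the union bound
  set A₁ := 𝒟'.image f₁ with hA₁
  set A₂ := 𝒟'.image f₂ with hA₂
  set A₃ := 𝒟'.image f₃ with hA₃
  have cA₁ : A₁.card = 𝒟'.card := card_image_of_injOn inj₁
  have cA₂ : A₂.card = 𝒟'.card := card_image_of_injOn inj₂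
  have cA₃ : A₃.card = 𝒟'.card := card_image_of_injOn inj₃
  have hsubT : A₁ ∪ A₂ ∪ A₃ ⊆ T := by
    intro p hp
    rcases mem_union.1 hp with hp | hp
    · rcases mem_union.1 hp with hp | hp
      · obtain ⟨τ, hτ, rfl⟩ := mem_image.1 hp; exact hf₁ τ hτ
      · obtain ⟨τ, hτ, rfl⟩ := mem_image.1 hp; exact hf₂ τ hτ
    · obtain ⟨τ, hτ, rfl⟩ := mem_image.1 hp; exact hf₃ τ hτ
  have hunion : (A₁.card : ℤ) + A₂.card + A₃.card - (A₁ ∩ A₂).card - (A₁ ∩ A₃).card - (A₂ ∩ A₃).card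
      ≤ (T.card : ℤ) := by
    have u1 := card_union_add_card_inter A₁ A₂
    have u2 := card_union_add_card_inter (A₁ ∪ A₂) A₃
    have u3 : ((A₁ ∪ A₂) ∩ A₃).card ≤ (A₁ ∩ A₃).card + (A₂ ∩ A₃).card := by
      rw [union_inter_distrib_right]; exact card_union_le _ _
    have u4 := card_le_card hsubT
    omega
  have hcard' : (𝒟.card : ℤ) - 1 ≤ 𝒟'.card := by
    by_cases hV𝒟 : V ∈ 𝒟
    · have := card_erase_add_one hV𝒟; rw [h𝒟']; omega
    · rw [h𝒟', erase_eq_of_notMem hV𝒟]; omega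
  -- Case split: is every point of `S₀` a vertex?
  by_cases hfull : S₀ ⊆ V
  · -- `V = S₀`, hence `V ∉ 𝒟` and `𝒟' = 𝒟`; each pair of images meets in at most one placement
    have hVS₀ : V = S₀ := Subset.antisymm hVS hfull
    -- the `ι`-least point of `S₀` is unique
    have uniq : ∀ a a' : α, a ∈ S₀ → a' ∈ S₀ → (∀ x ∈ S₀, ι a ≤ ι x) → (∀ x ∈ S₀, ι a' ≤ ι x) → a = a' :=
      fun a a' ha ha' hm hm' => hι (le_antisymm (hm a' ha') (hm' a ha))
    -- key: from `ι (v σ) ≤ ι b` where `{v σ, b} = S₀ \ σ`... packaged as: if `a ∈ S₀`, `ι a ≤ ι (v {a})` and `{a} ∈ 𝒟'`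
    -- then `a` is the least point of `S₀`
    have least : ∀ a : α, a ∈ S₀ → ({a} : Finset α) ∈ 𝒟' → ι a ≤ ι (v {a}) → ∀ x ∈ S₀, ι a ≤ ι x := by
      intro a ha ha' hle x hx
      by_cases hxa : x = a
      · rw [hxa]
      · have hx' : x ∈ V \ {a} := mem_sdiff.2 ⟨hfull hx, fun hh => hxa (mem_singleton.1 hh)⟩
        exact hle.trans (hvmin {a} ha' x hx')
    -- two-point complements: if `S₀ \ insert a σ = {b}` with `σ ∈ 𝒟'`, `v σ = a`, then `ι a ≤ ι b`
    have vle : ∀ σ ∈ 𝒟', ∀ b : α, b ∈ S₀ → b ∉ σ → ι (v σ) ≤ ι b := by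
      intro σ hσ b hb hbσ
      exact hvmin σ hσ b (mem_sdiff.2 ⟨hfull hb, hbσ⟩)
    have i12 : (A₁ ∩ A₂).card ≤ 1 := by
      refine card_le_one.2 fun p hp p' hp' => ?_
      -- any element of `A₁ ∩ A₂` is `f₁ {a}` with `a` the least point
      have shape : ∀ q ∈ A₁ ∩ A₂, ∃ a, a ∈ S₀ ∧ (∀ x ∈ S₀, ι a ≤ ι x) ∧ ({a} : Finset α) ∈ 𝒟' ∧ q = f₁ {a} := by
        intro q hq
        obtain ⟨hq1, hq2⟩ := mem_inter.1 hq
        obtain ⟨τ, hτ, rfl⟩ := mem_image.1 hq1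
        obtain ⟨σ, hσ, hστ⟩ := mem_image.1 hq2
        -- f₂ σ = f₁ τ : {v σ} = τ and S₀ \ insert (v σ) σ = {v τ}
        have e1 : ({v σ} : Finset α) = τ := congrArg Sigma.fst hστ
        have e2 : S₀ \ insert (v σ) σ = {v τ} := eq_of_heq (Sigma.mk.inj hστ).2
        obtain ⟨hσS, _, haS, haσ, _, _, _⟩ := vfacts σ hσ
        refine ⟨v σ, haS, least (v σ) haS (e1.symm ▸ hτ) ?_, e1.symm ▸ hτ, by rw [e1]⟩
        -- b := v τ lies in S₀ \ σ and v σ is least there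
        have hb : v τ ∈ S₀ \ insert (v σ) σ := by rw [e2]; exact mem_singleton_self _
        obtain ⟨hbS, hbn⟩ := mem_sdiff.1 hb
        rw [mem_insert, not_or] at hbn
        rw [e1]
        exact vle σ hσ (v τ) hbS hbn.2
      obtain ⟨a, ha, hma, _, rfl⟩ := shape p hp
      obtain ⟨a', ha', hma', _, rfl⟩ := shape p' hp'
      rw [uniq a a' ha ha' hma hma']
    have i13 : (A₁ ∩ A₃).card ≤ 1 := by
      refine card_le_one.2 fun p hp p' hp' => ?_
      have shape : ∀ q ∈ A₁ ∩ A₃, ∃ b, b ∈ S₀ ∧ (∀ x ∈ S₀, ι b ≤ ι x) ∧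
          q = ⟨S₀ \ insert (v {b}) {b}, {b}⟩ := by
        intro q hq
        obtain ⟨hq1, hq3⟩ := mem_inter.1 hq
        obtain ⟨τ, hτ, rfl⟩ := mem_image.1 hq1
        obtain ⟨σ, hσ, hστ⟩ := mem_image.1 hq3
        -- f₃ σ = f₁ τ : S₀ \ insert (v σ) σ = τ and σ = {v τ}
        have e1 : S₀ \ insert (v σ) σ = τ := congrArg Sigma.fst hστ
        have e2 : σ = {v τ} := eq_of_heq (Sigma.mk.inj hστ).2
        obtain ⟨hτS, _, hbS, hbτ, _, _, _⟩ := vfacts τ hτ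
        obtain ⟨hσS, _, hcS, hcσ, _, _, _⟩ := vfacts σ hσ
        have hσ' : ({v τ} : Finset α) ∈ 𝒟' := e2 ▸ hσ
        refine ⟨v τ, hbS, least (v τ) hbS hσ' ?_, ?_⟩
        · -- c := v σ = v {v τ} ∉ τ, c ∈ S₀: v τ least in V \ τ ∋ c
          rw [← e2]
          refine hvmin τ hτ (v σ) (mem_sdiff.2 ⟨hfull hcS, fun hc => ?_⟩)
          rw [← e1, mem_sdiff, mem_insert] at hc
          exact hc.2 (Or.inl rfl)
        · show (⟨τ, {v τ}⟩ : Σ _ : Finset α, Finset α) = _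
          rw [← e2, e1]
      obtain ⟨b, hb, hmb, rfl⟩ := shape p hp
      obtain ⟨b', hb', hmb', rfl⟩ := shape p' hp'
      rw [uniq b b' hb hb' hmb hmb']
    have i23 : (A₂ ∩ A₃).card ≤ 1 := by
      refine card_le_one.2 fun p hp p' hp' => ?_
      have shape : ∀ q ∈ A₂ ∩ A₃, ∃ a, a ∈ S₀ ∧ (∀ x ∈ S₀, ι a ≤ ι x) ∧ ({a} : Finset α) ∈ 𝒟' ∧ q = f₂ {a} := by
        intro q hq
        obtain ⟨hq2, hq3⟩ := mem_inter.1 hq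
        obtain ⟨τ, hτ, rfl⟩ := mem_image.1 hq2
        obtain ⟨σ, hσ, hστ⟩ := mem_image.1 hq3
        -- f₃ σ = f₂ τ : S₀ \ insert (v σ) σ = {v τ} and σ = S₀ \ insert (v τ) τ
        have e1 : S₀ \ insert (v σ) σ = {v τ} := congrArg Sigma.fst hστ
        have e2 : σ = S₀ \ insert (v τ) τ := eq_of_heq (Sigma.mk.inj hστ).2
        obtain ⟨hτS, _, hbS, hbτ, _, _, _⟩ := vfacts τ hτ
        obtain ⟨hσS, _, haS, haσ, _, _, _⟩ := vfacts σ hσ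
        -- third blocks: τ = {v σ}
        have e3 : τ = {v σ} := by
          rw [← (sdiff_blocks_point hτS hbS hbτ).1, ← (sdiff_blocks_point hσS haS haσ).2.1, e1, e2, union_comm]
        have hτ' : ({v σ} : Finset α) ∈ 𝒟' := e3 ▸ hτ
        refine ⟨v σ, haS, least (v σ) haS hτ' ?_, hτ', by rw [← e3]⟩
        rw [← e3]
        -- b := v τ ∈ S₀ \ σ
        have hb : v τ ∈ S₀ \ insert (v σ) σ := by rw [e1]; exact mem_singleton_self _
        obtain ⟨_, hbn⟩ := mem_sdiff.1 hb
        rw [mem_insert, not_or] at hbn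
        exact vle σ hσ (v τ) hbS hbn.2
      obtain ⟨a, ha, hma, _, rfl⟩ := shape p hp
      obtain ⟨a', ha', hma', _, rfl⟩ := shape p' hp'
      rw [uniq a a' ha ha' hma hma']
    have hV𝒟 : V ∉ 𝒟 := fun h => (mem_propers.1 (hD1 h)).2.2 hVS₀
    have h𝒟𝒟 : 𝒟' = 𝒟 := by rw [h𝒟', erase_eq_of_notMem hV𝒟]
    rw [h𝒟𝒟] at cA₁ cA₂ cA₃
    have : ((A₁ ∩ A₂).card : ℤ) + (A₁ ∩ A₃).card + (A₂ ∩ A₃).card ≤ 3 := by omega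
    rw [cA₁, cA₂, cA₃] at hunion
    linarith
  · -- some point `z ∈ S₀ ∖ V`: the images are pairwise disjoint
    obtain ⟨z, hzS, hzV⟩ := not_subset.1 hfull
    have zR : ∀ τ ∈ 𝒟', z ∈ S₀ \ insert (v τ) τ := by
      intro τ hτ
      obtain ⟨_, _, _, _, hv𝒟, hτ𝒟, _⟩ := vfacts τ hτ
      refine mem_sdiff.2 ⟨hzS, fun hh => ?_⟩
      rcases mem_insert.1 hh with rfl | hh
      · exact hzV (memV.2 ⟨hzS, hv𝒟⟩)
      · exact hzV (subV τ hτ𝒟 hh)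
    have zv : ∀ τ ∈ 𝒟', z ≠ v τ := by
      intro τ hτ hh
      obtain ⟨_, _, _, _, hv𝒟, _, _⟩ := vfacts τ hτ
      exact hzV (memV.2 ⟨hzS, hh ▸ hv𝒟⟩)
    have d12 : A₁ ∩ A₂ = ∅ := by
      refine eq_empty_iff_forall_notMem.2 fun q hq => ?_
      obtain ⟨hq1, hq2⟩ := mem_inter.1 hq
      obtain ⟨τ, hτ, rfl⟩ := mem_image.1 hq1
      obtain ⟨σ, hσ, hστ⟩ := mem_image.1 hq2
      have e2 : S₀ \ insert (v σ) σ = {v τ} := eq_of_heq (Sigma.mk.inj hστ).2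
      have := zR σ hσ
      rw [e2, mem_singleton] at this
      exact zv τ hτ this
    have d13 : A₁ ∩ A₃ = ∅ := by
      refine eq_empty_iff_forall_notMem.2 fun q hq => ?_
      obtain ⟨hq1, hq3⟩ := mem_inter.1 hq
      obtain ⟨τ, hτ, rfl⟩ := mem_image.1 hq1
      obtain ⟨σ, hσ, hστ⟩ := mem_image.1 hq3
      have e1 : S₀ \ insert (v σ) σ = τ := congrArg Sigma.fst hστ
      have := zR σ hσ
      rw [e1] at this
      exact hzV (subV τ (h𝒟'sub hτ) this)
    have d23 : A₂ ∩ A₃ = ∅ := by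
      refine eq_empty_iff_forall_notMem.2 fun q hq => ?_
      obtain ⟨hq2, hq3⟩ := mem_inter.1 hq
      obtain ⟨τ, hτ, rfl⟩ := mem_image.1 hq2
      obtain ⟨σ, hσ, hστ⟩ := mem_image.1 hq3
      have e1 : S₀ \ insert (v σ) σ = {v τ} := congrArg Sigma.fst hστ
      have := zR σ hσ
      rw [e1, mem_singleton] at this
      exact zv τ hτ this
    rw [d12, d13, d23, card_empty, cA₁, cA₂, cA₃] at hunion
    push_cast at hunion
    linarith

end Summit.CriticalPhenomena.PercolationContinuityZ3.Theorems.SunflowerPartition
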